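import Mathlib
import Summits.ValiantsHypothesis.ValiantsHypothesis.Theorems.GrenetZeonTwoDimCoefficientsScalingRankOnePointHessian
import Summits.ValiantsHypothesis.ValiantsHypothesis.Theorems.GrenetZeonTwoDimCoefficientsScalingMonomialPointHessian

/-!
# Crux `GrenetZeon.TwoDimCoefficients` (stmt-ValiantsHypothesis-8062) / rung `DualUnipotentThreeHalves` (stmt-24318):
# scaling-closure — PG(1): EVERY HYPERPLANE OF `M_n(ℂ)` CONTAINS A FULL-RANK POINT OF `Hess per_n`

Per-genericity in codimension one for the T4 programme of the 24318 decl (memo NINETEENTH-HAND.md §3): the Hessian-degeneracy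
locus `{z : rank Hess per_n(z) < n²}` of the permanent contains NO hyperplane (`n ≥ 2`).  Equivalently: a unipotent dual
representation padded with ONE scalar garbage block `ℓ(x)·J_{n+1}` (which forces every index-reducing substitution into `ker ℓ`)
still admits a substitution point of full Hessian rank.  Proof by the three explicit full-rank families: permutation points
(✓ p836772), monomial points (✓ `rank_hess0_transl_monomialPoint_perPoly`) and rank-one points (✓ p837075):
if some permutation sum `Σ_c ℓ_{τc,c}` vanishes use `P_τ`; if `ℓ` has two non-zero coefficients in distinct rows and columns use a
monomial point on a permutation through them; otherwise `ℓ` is supported on one FULL row (or column) and the rank-one point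
`𝟙 vᵀ` (`u 𝟙ᵀ`) with `Σ_c ℓ_{rc} v_c = 0` works.

* `exists_forall_ne_zero_sum_mul_eq_zero` — a vector with two non-zero coordinates has an all-non-zero orthogonal vector;
* ★★ `exists_fullRank_hess0_perPoly_of_linearForm` — `∀ ℓ, ∃ z, ℓ(z) = 0 ∧ rank Hess per_n(z) = n²` (`n ≥ 2`).

HONEST FRAMING: an unconditional, route-independent theorem about the permanent (no Theses import).  It discharges the
per-genericity clause of T4 only for sections forced into ONE hyperplane; PG-weak(k) for `2 ≤ k ≤ n/4`, INDEX-COST, the stub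
`DualUnipotentBound`, crux 8062, the 24318 decl and `VP ≠ VNP` remain open.

References: T. Mignon, N. Ressayre, Int. Math. Res. Not. 2004:79, §3 (via the tree); folklore.
-/

-- single-conjunct layout `Summits/ValiantsHypothesis/ValiantsHypothesis`: the duplicated namespace
-- component is mandated by the tree.
set_option linter.dupNamespace false
set_option autoImplicit false

noncomputable section

namespace Summit.ValiantsHypothesis.ValiantsHypothesis.Theorems.GrenetZeonTwoDimCoefficients.ScalingClosure

open MvPolynomial Matrix
open Literature.Computability.AlgebraicComplexity

section HyperplanePerGenericity

variable {n : ℕ}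

/-- A vector `w` with two non-zero coordinates `c₁ ≠ c₂` admits an orthogonal vector `v` (`Σ w_c v_c = 0`) with ALL coordinates
non-zero: `v = 1` off `{c₁, c₂}`, `v_{c₂} ∈ {1, 2}`, `v_{c₁}` solved for. [folklore] -/
theorem exists_forall_ne_zero_sum_mul_eq_zero (w : Fin n → ℂ) {c₁ c₂ : Fin n} (hc : c₁ ≠ c₂) (h1 : w c₁ ≠ 0)
    (h2 : w c₂ ≠ 0) : ∃ v : Fin n → ℂ, (∀ c, v c ≠ 0) ∧ ∑ c, w c * v c = 0 := by
  classical
  set s : ℂ := ∑ c ∈ (Finset.univ.erase c₁).erase c₂, w c with hs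
  -- choose `β ∈ {1, 2}` with `s + w c₂ * β ≠ 0`
  obtain ⟨β, hβ0, hβ⟩ : ∃ β : ℂ, β ≠ 0 ∧ s + w c₂ * β ≠ 0 := by
    by_cases h : s + w c₂ * 1 ≠ 0
    · exact ⟨1, one_ne_zero, h⟩
    · refine ⟨2, two_ne_zero, ?_⟩
      push Not at h
      intro h'
      apply h2
      linear_combination h' - h
  set α : ℂ := -(s + w c₂ * β) / w c₁ with hα
  have hα0 : α ≠ 0 := by
    rw [hα]
    exact div_ne_zero (neg_ne_zero.mpr hβ) h1
  refine ⟨fun c => if c = c₁ then α else if c = c₂ then β else 1, fun c => ?_, ?_⟩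
  · dsimp only
    split_ifs
    · exact hα0
    · exact hβ0
    · exact one_ne_zero
  · rw [← Finset.sum_erase_add _ _ (Finset.mem_univ c₁),
      ← Finset.sum_erase_add _ _ (Finset.mem_erase.mpr ⟨hc.symm, Finset.mem_univ c₂⟩)]
    have hrest : ∑ c ∈ (Finset.univ.erase c₁).erase c₂,
        w c * (if c = c₁ then α else if c = c₂ then β else 1) = s := by
      rw [hs]
      refine Finset.sum_congr rfl fun c hc' => ?_
      have hc'' : c ≠ c₂ ∧ c ≠ c₁ := by simpa [Finset.mem_erase] using hc'
      rw [if_neg hc''.2, if_neg hc''.1, mul_one]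
    rw [hrest]
    dsimp only
    rw [if_neg hc.symm, if_pos rfl, if_pos rfl, hα]
    field_simp
    ring

/-- The value of the linear form `Σ_p ℓ_p z_p` at a monomial point: `Σ_c ℓ_{τc,c} t_c`. [folklore] -/
theorem sum_mul_monomialPoint (L : Fin n × Fin n → ℂ) (τ : Equiv.Perm (Fin n)) (t : Fin n → ℂ) :
    ∑ p : Fin n × Fin n, L p * (fun u : Fin n × Fin n => if u.1 = τ u.2 then t u.2 else 0) p =
      ∑ c, L (τ c, c) * t c := by
  classical
  rw [Fintype.sum_prod_type_right]
  refine Finset.sum_congr rfl fun c _ => ?_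
  rw [Finset.sum_eq_single (τ c)]
  · simp
  · intro r _ hr
    dsimp only
    rw [if_neg hr, mul_zero]
  · intro h; exact absurd (Finset.mem_univ _) h

/-- A permutation with two prescribed values `τ c₁ = r₁`, `τ c₂ = r₂` (`c₁ ≠ c₂`, `r₁ ≠ r₂`). [folklore] -/
theorem exists_perm_apply_eq_two {c₁ c₂ r₁ r₂ : Fin n} (hc : c₁ ≠ c₂) (hr : r₁ ≠ r₂) :
    ∃ τ : Equiv.Perm (Fin n), τ c₁ = r₁ ∧ τ c₂ = r₂ := by
  classical
  set σ : Equiv.Perm (Fin n) := Equiv.swap c₁ r₁ with hσ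
  have hσ1 : σ c₁ = r₁ := by rw [hσ, Equiv.swap_apply_left]
  have hσ2 : σ c₂ ≠ r₁ := by
    rw [← hσ1]
    exact fun h => hc (σ.injective h).symm
  refine ⟨Equiv.swap (σ c₂) r₂ * σ, ?_, ?_⟩
  · rw [Equiv.Perm.mul_apply, hσ1, Equiv.swap_apply_of_ne_of_ne hσ2.symm hr]
  · rw [Equiv.Perm.mul_apply, Equiv.swap_apply_left]

/-- ★★ **PG(1): every hyperplane of `M_n(ℂ)` contains a full-rank point of the Hessian of the permanent** (`n ≥ 2`): for every
coefficient vector `ℓ` there is `z` with `Σ_p ℓ_p z_p = 0` and `rank Hess per_n(z) = n²`.  (Cases: a vanishing permutation sum ⇒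
permutation point; two non-zero coefficients in distinct rows and columns ⇒ monomial point; else `ℓ` lives on one full row or
column ⇒ rank-one point.) [cite: MignonRessayre2004, §3 — via the tree; folklore] -/
theorem exists_fullRank_hess0_perPoly_of_linearForm (hn : 2 ≤ n) (L : Fin n × Fin n → ℂ) :
    ∃ z : Fin n × Fin n → ℂ, ∑ p, L p * z p = 0 ∧ (hess0 (transl z (perPoly (Fin n) ℂ))).rank = n ^ 2 := by
  classical
  -- Case 1: a vanishing permutation sum
  by_cases hperm : ∃ τ : Equiv.Perm (Fin n), ∑ c, L (τ c, c) = 0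
  · obtain ⟨τ, hτ⟩ := hperm
    refine ⟨fun u : Fin n × Fin n => if u.1 = τ u.2 then (1 : ℂ) else 0, ?_,
      rank_hess0_transl_permPoint_perPoly hn τ⟩
    have h := sum_mul_monomialPoint L τ (fun _ => 1)
    simp only [mul_one] at h
    rw [h, hτ]
  -- Case 2: two non-zero coefficients in general position
  by_cases hgen : ∃ p₁ p₂ : Fin n × Fin n, p₁.1 ≠ p₂.1 ∧ p₁.2 ≠ p₂.2 ∧ L p₁ ≠ 0 ∧ L p₂ ≠ 0
  · obtain ⟨⟨r₁, c₁⟩, ⟨r₂, c₂⟩, hr, hc, h1, h2⟩ := hgen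
    dsimp only at hr hc h1 h2
    obtain ⟨τ, hτ1, hτ2⟩ := exists_perm_apply_eq_two hc hr
    obtain ⟨t, ht, hsum⟩ := exists_forall_ne_zero_sum_mul_eq_zero (fun c => L (τ c, c)) hc
      (by rw [hτ1]; exact h1) (by rw [hτ2]; exact h2)
    refine ⟨fun u : Fin n × Fin n => if u.1 = τ u.2 then t u.2 else 0, ?_,
      rank_hess0_transl_monomialPoint_perPoly hn τ t ht⟩
    rw [sum_mul_monomialPoint, hsum]
  -- Case 3: `L` lives on one full row or one full column
  push Not at hperm hgen
  have hL0 : ∃ p₀, L p₀ ≠ 0 := by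
    by_contra h
    push Not at h
    apply hperm 1
    exact Finset.sum_eq_zero fun c _ => h _
  obtain ⟨⟨r₀, c₀⟩, h0⟩ := hL0
  have hn' : ∃ c : Fin n, c ≠ c₀ := by
    obtain ⟨k, hk⟩ : ∃ k, n = k + 2 := ⟨n - 2, by omega⟩
    subst hk
    by_cases h : (0 : Fin (k + 2)) = c₀
    · exact ⟨1, by rw [← h]; exact Fin.zero_ne_one.symm⟩
    · exact ⟨0, h⟩
  by_cases hrow : ∀ p, L p ≠ 0 → p.1 = r₀
  · -- row-supported; the row must be full, else a permutation sum vanishes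
    have hfull : ∀ c, L (r₀, c) ≠ 0 := by
      intro c hc
      apply hperm (Equiv.swap c r₀)
      refine Finset.sum_eq_zero fun c' _ => ?_
      by_cases hcc : c' = c
      · rw [hcc, Equiv.swap_apply_left, hc]
      · by_contra hne
        have h1 := hrow _ hne
        dsimp only at h1
        have : Equiv.swap c r₀ c' = Equiv.swap c r₀ c := by rw [h1, Equiv.swap_apply_left]
        exact hcc ((Equiv.swap c r₀).injective this)
    obtain ⟨c₁, hc₁⟩ := hn'
    obtain ⟨v, hv, hsum⟩ := exists_forall_ne_zero_sum_mul_eq_zero (fun c => L (r₀, c)) hc₁ (hfull c₁) (hfull c₀)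
    refine ⟨fun q : Fin n × Fin n => (fun _ => (1 : ℂ)) q.1 * v q.2, ?_,
      rank_hess0_transl_rankOne_perPoly hn (fun _ => 1) v (fun _ => one_ne_zero) hv⟩
    simp only [one_mul]
    rw [Fintype.sum_prod_type, Finset.sum_eq_single r₀]
    · simpa using hsum
    · intro r _ hr
      refine Finset.sum_eq_zero fun c _ => ?_
      have : L (r, c) = 0 := by
        by_contra hne
        exact hr (hrow _ hne)
      rw [this, zero_mul]
    · intro h; exact absurd (Finset.mem_univ _) h
  · -- not row-supported: then column-supported on column `c₀`
    push Not at hrow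
    obtain ⟨⟨r₁, c₁⟩, h1, hr1⟩ := hrow
    dsimp only at hr1
    have hc1 : c₁ = c₀ := by
      by_contra hne
      exact h0 (hgen (r₁, c₁) (r₀, c₀) hr1 hne h1)
    subst hc1
    have hcol : ∀ p, L p ≠ 0 → p.2 = c₁ := by
      rintro ⟨r, c⟩ hp
      dsimp only
      by_contra hne
      -- `(r,c)` vs `(r₀,c₁)`: distinct columns ⇒ same row; vs `(r₁,c₁)`: same row too; contradiction
      have e0 : r = r₀ := by
        by_contra hre
        exact h0 (hgen (r, c) (r₀, c₁) hre hne hp)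
      have e1 : r = r₁ := by
        by_contra hre
        exact h1 (hgen (r, c) (r₁, c₁) hre hne hp)
      exact hr1 (e1.symm.trans e0)
    have hfull : ∀ r, L (r, c₁) ≠ 0 := by
      intro r hr
      apply hperm (Equiv.swap c₁ r)
      refine Finset.sum_eq_zero fun c' _ => ?_
      by_cases hcc : c' = c₁
      · rw [hcc, Equiv.swap_apply_left, hr]
      · by_contra hne
        exact hcc (hcol _ hne)
    obtain ⟨u, hu, hsum⟩ := exists_forall_ne_zero_sum_mul_eq_zero (fun r => L (r, c₁)) hr1 h1 h0
    refine ⟨fun q : Fin n × Fin n => u q.1 * (fun _ => (1 : ℂ)) q.2, ?_,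
      rank_hess0_transl_rankOne_perPoly hn u (fun _ => 1) hu (fun _ => one_ne_zero)⟩
    simp only [mul_one]
    rw [Fintype.sum_prod_type_right, Finset.sum_eq_single c₁]
    · simpa using hsum
    · intro c _ hc
      refine Finset.sum_eq_zero fun r _ => ?_
      have : L (r, c) = 0 := by
        by_contra hne
        exact hc (hcol _ hne)
      rw [this, zero_mul]
    · intro h; exact absurd (Finset.mem_univ _) h

/-- ★★ **PG-weak(1) in subspace form**: every linear subspace of `M_n(ℂ)` of codimension `≤ 1` contains a point at which the
Hessian of `per_n` has full rank `n²` (`n ≥ 2`) — the `k = 1` instance (with `κ′ = 0`) of the per-genericity statement PG-weak(k)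
that the T4 programme needs for `k ≤ n/4` (memo NINETEENTH-HAND.md §3). [cite: MignonRessayre2004, §3 — via the tree; folklore] -/
theorem exists_mem_fullRank_hess0_perPoly_of_codim_le_one (hn : 2 ≤ n) (V : Submodule ℂ (Fin n × Fin n → ℂ))
    (hV : n ^ 2 ≤ Module.finrank ℂ V + 1) :
    ∃ z ∈ V, (hess0 (transl z (perPoly (Fin n) ℂ))).rank = n ^ 2 := by
  classical
  by_cases htop : V = ⊤
  · obtain ⟨z, -, hz⟩ := exists_fullRank_hess0_perPoly_of_linearForm hn (fun _ => 0)
    exact ⟨z, htop ▸ Submodule.mem_top, hz⟩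
  · obtain ⟨f, hf0, hVf⟩ := Submodule.exists_le_ker_of_lt_top V (lt_top_iff_ne_top.mpr htop)
    -- the coefficient vector of `f`
    obtain ⟨z, hz0, hz⟩ :=
      exists_fullRank_hess0_perPoly_of_linearForm hn (fun p => f (fun q => if p = q then 1 else 0))
    have hfz : f z = 0 := by
      have h : f z = ∑ p : Fin n × Fin n, f (fun q => if p = q then 1 else 0) * z p := by
        rw [LinearMap.pi_apply_eq_sum_univ f z]
        exact Finset.sum_congr rfl fun p _ => by rw [smul_eq_mul, mul_comm]
      rw [h]
      simpa using hz0
    -- `V = ker f` by dimension count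
    have hker_lt : LinearMap.ker f < ⊤ := by
      rw [lt_top_iff_ne_top]
      intro h
      apply hf0
      refine LinearMap.ext fun x => ?_
      have hx : x ∈ LinearMap.ker f := h ▸ Submodule.mem_top
      rw [LinearMap.zero_apply]
      exact LinearMap.mem_ker.mp hx
    have hdim : Module.finrank ℂ (LinearMap.ker f) ≤ Module.finrank ℂ V := by
      have h1 := Submodule.finrank_lt_finrank_of_lt hker_lt
      rw [finrank_top, Module.finrank_fintype_fun_eq_card, Fintype.card_prod, Fintype.card_fin] at h1
      have h2 : n ^ 2 = n * n := sq n
      omega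
    have hVeq : V = LinearMap.ker f := Submodule.eq_of_le_of_finrank_le hVf hdim
    refine ⟨z, ?_, hz⟩
    rw [hVeq, LinearMap.mem_ker]
    exact hfz

end HyperplanePerGenericity

end Summit.ValiantsHypothesis.ValiantsHypothesis.Theorems.GrenetZeonTwoDimCoefficients.ScalingClosure

end
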